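import Literature.AnabelianGeometry.AbsoluteAnabelian.GaloisCyclotomeH2Levels
import Literature.AnabelianGeometry.AbsoluteAnabelian.GaloisCyclotomeTower
import Literature.AnabelianGeometry.EtaleTheta.CyclotomeHomQmodZ
import Mathlib.Algebra.Module.Torsion.Basic
import HarnessLib

/-!
# `H²(G_K, μ_{ℚ/ℤ})[n] = H²(G_K, μ_n)` and `Hom(ℚ/ℤ, H²(G_K, μ_{ℚ/ℤ})) = lim_i H²(G_K, μ_{(i+1)!})`

abc-iut cell, layer L4, sub-DAG `plan/L4/SUBDAG-AbsTopIII-Prop32.md`, node AbsTopIII:Prop3.2(i), sub-row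
«Prop32i-GENUINE-H2» steps (S1)–(S2) (spec: HOME/HANDOFF.md, abc-iut-w4-d045 2026-08-26T08:16:46Z; seat
abc-iut-w6-d075).  S. Mochizuki, *Topics in absolute anabelian geometry III* (2015), Prop. 3.2 (i) p. 71 l. 57–60:
`H²(G, μ_Ẑ(M_TM)) ⥲ Ẑ` is obtained from «the resulting isomorphism `H²(G, μ_{ℚ/ℤ}(M_TM)) ⥲ ℚ/ℤ`» by «applying the
functor `Hom(ℚ/ℤ, −)`» (Cor. 1.10 (i)(a) p. 42: `μ_Ẑ(G_k) := Hom(ℚ/ℤ, μ_{ℚ/ℤ}(G_k))`).  The tree's `μ_{ℚ/ℤ}`-level object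
is `Prop121vii.H2MuQZ K = colim_n H²(G_K, μ_n)` (`LocalResidueMapQmodZ.lean`, residue isomorphism `invariantQZEquiv`);
the `μ_Ẑ`-level one is computed along the factorial tower `galCyclotomeTower` (`GaloisCyclotomeTower.lean`) by
`DiscreteTowerPresentation.limitClassesEquiv : H²(G_k, μ_Ẑ(G_k)) ≃+ lim_i H²(G_k, μ_{(i+1)!})` (NSW (2.7.6)).
This file supplies, for a `p`-adic local field `K` of characteristic `0`, the two identifications in between:

* (S1) `H2MuQZ.of n : H²(G_K, μ_n) → H²(G_K, μ_{ℚ/ℤ})` is injective with image the `n`-torsion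
  (`H2MuQZ.of_injective`, `H2MuQZ.exists_of_eq_of_nsmul_eq_zero`; `H2MuQZ.torsionEquiv n : H²(G_K, μ_n) ≃+
  H²(G_K, μ_{ℚ/ℤ})[n]`), and multiplication by `N/n` matches the power map `H²(μ_N ↠ μ_n)`
  (`H2MuQZ.of_cohomologyMap_muPowHom`, from abc-iut-L4-t17's `cohomologyMap_muInclHom_muPowHom`);
* (S2) `H2MuQZ.homQmodZChainEquiv : (ℚ/ℤ →+ H²(G_K, μ_{ℚ/ℤ})) ≃+ H2MuChainClasses K`, the group of families in
  `∏_i H²(G_K, μ_{(i+1)!})` compatible under the power maps — BY DEFINITION `(galCyclotomeTower φ hφ).limitClasses`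
  (`limitClasses_galCyclotomeTower`, `rfl`): `f ↦` (the level-`(i+1)!` class under `f(1/(i+1)!)`)_i, inverse
  `c ↦ (1/n ↦ ((i+1)!/n) · of (c_i))` (`i = n - 1`) assembled by `EtaleTheta.cyclotome.toHom` («`Hom(ℚ/ℤ, A) ≅ Λ(A)`»);
  `invariantQZ_apply_coe_one_div_cycLevel` reads the residues levelwise.

Steps (S3) `limitClassesEquiv` (in tree) and (S4) the `Ẑ`-valued `h2Iso` (abc-iut-L4-t17) are NOT touched.  No named
fact; the `def`s are the equivalences, their constituents and the subgroup `H2MuChainClasses`.  HONEST FRAMING: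
classical Galois-cohomology bookkeeping (Serre, *Local Fields* XIII §3; NSW (2.7.5)); nothing here bears on
[IUTchIII] Cor. 3.12 or takes a side; typed ≠ proved.
-/


noncomputable section

universe u

namespace Literature.AnabelianGeometry.AbsoluteAnabelian

open Field Function CategoryTheory
open Literature.NumberTheory.GaloisRepresentations
open Literature.NumberTheory.GaloisRepresentations.DiscreteGaloisModule
open Literature.AnabelianGeometry.EtaleTheta

namespace Prop121vii

/-- `d • (1/N) = 1/n` in `ℚ/ℤ = AddCircle (1 : ℚ)` when `n * d = N`. [cite: MochizukiAbsTopIII2015, Definition 3.1 (v) p.69] -/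
theorem nsmul_coe_one_div {n N : ℕ+} {d : ℕ} (h : (n : ℕ) * d = N) :
    d • ((((1 : ℚ) / (N : ℕ) : ℚ)) : AddCircle (1 : ℚ)) = (((1 : ℚ) / (n : ℕ) : ℚ) : AddCircle (1 : ℚ)) := by
  rw [← AddCircle.coe_nsmul, nsmul_eq_mul]
  congr 1
  have hn : ((n : ℕ) : ℚ) ≠ 0 := Nat.cast_ne_zero.2 n.ne_zero
  have hd : (d : ℚ) ≠ 0 := Nat.cast_ne_zero.2 fun hd0 => N.ne_zero (by rw [← h, hd0, mul_zero])
  rw [← h, Nat.cast_mul]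
  field_simp

/-- Two homomorphisms out of `ℚ/ℤ` that agree on every `1/n` are equal (via `cyclotome.ofHom_injective`).
[cite: MochizukiAbsTopIII2015, Definition 3.1 (v) p.69] -/
theorem addMonoidHom_addCircle_ext {A : Type u} [AddCommGroup A] {f g : AddCircle (1 : ℚ) →+ A}
    (h : ∀ n : ℕ+, f ((((1 : ℚ) / (n : ℕ) : ℚ)) : AddCircle (1 : ℚ)) =
      g ((((1 : ℚ) / (n : ℕ) : ℚ)) : AddCircle (1 : ℚ))) : f = g := by
  have hfg : AddMonoidHom.toMultiplicative f = AddMonoidHom.toMultiplicative g := by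
    apply cyclotome.ofHom_injective (A := Multiplicative A)
    refine Subtype.ext (funext fun n => ?_)
    rw [cyclotome.ofHom_apply_coe, cyclotome.ofHom_apply_coe, AddMonoidHom.coe_toMultiplicative,
      AddMonoidHom.coe_toMultiplicative]
    change Multiplicative.ofAdd (f _) = Multiplicative.ofAdd (g _)
    rw [toAdd_ofAdd, h n]
  exact AddMonoidHom.toMultiplicative.injective hfg

/-! ### (S1) `H²(G_K, μ_n)` is the `n`-torsion of `H²(G_K, μ_{ℚ/ℤ})` -/

section Torsion

variable (K : Type u) [Field K] [ValuativeRel K] [TopologicalSpace K] [IsNonarchimedeanLocalField K]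
  [CharZero K]

/-- `H²(G_K, μ_n)` is killed by `n` (read off THE residue map `inv_n ⥲ ℤ/n`). [cite: SerreLocalFields1979, XIII §3] -/
theorem nsmul_self_galoisCohomology_mu_two (n : ℕ) [NeZero n] (x : galoisCohomology (mu K n) 2) :
    n • x = 0 := by
  apply (invLevel_bijective K n).1
  rw [map_nsmul, map_zero, nsmul_eq_mul, ZMod.natCast_self, zero_mul]

variable {K}

/-- The image of `H²(G_K, μ_n) → H²(G_K, μ_{ℚ/ℤ})` is `n`-torsion. [cite: MochizukiAbsAnab2004, Prop 1.2.1 (vii) p.11] -/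
theorem H2MuQZ.nsmul_of (n : ℕ+) (x : galoisCohomology (mu K (n : ℕ)) 2) :
    (n : ℕ) • H2MuQZ.of n x = 0 := by
  haveI : NeZero ((n : ℕ+) : ℕ) := ⟨n.ne_zero⟩
  rw [← map_nsmul, nsmul_self_galoisCohomology_mu_two K (n : ℕ) x, map_zero]

/-- **`H²(G_K, μ_n) → H²(G_K, μ_{ℚ/ℤ})` is injective** (the residue of a level-`n` class is `inv_n/n`,
and `ℤ/n ↪ ℚ/ℤ`). [cite: MochizukiAbsAnab2004, Prop 1.2.1 (vii) p.11] -/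
theorem H2MuQZ.of_injective (n : ℕ+) : Injective (H2MuQZ.of (K := K) n) := by
  haveI : NeZero ((n : ℕ+) : ℕ) := ⟨n.ne_zero⟩
  refine (injective_iff_map_eq_zero _).2 fun x hx => ?_
  have h1 : zmodToQmodZ (n : ℕ) (invLevel K (n : ℕ) x) = 0 := by
    rw [← invariantQZ_of', hx, map_zero]
  have h2 : invLevel K (n : ℕ) x = 0 := zmodToQmodZ_injective _ (by rw [h1, map_zero])
  exact (invLevel_bijective K (n : ℕ)).1 (by rw [h2, map_zero])

/-- **Every `n`-torsion class of `H²(G_K, μ_{ℚ/ℤ})` comes from level `n`**: if `n • z = 0` then `z = of n x`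
(its residue is `m/n`, `m < n`; take `x := inv_n⁻¹(m)`). [cite: MochizukiAbsAnab2004, Prop 1.2.1 (vii) p.11] -/
theorem H2MuQZ.exists_of_eq_of_nsmul_eq_zero {n : ℕ+} {z : H2MuQZ K} (hz : (n : ℕ) • z = 0) :
    ∃ x : galoisCohomology (mu K (n : ℕ)) 2, H2MuQZ.of n x = z := by
  haveI : NeZero ((n : ℕ+) : ℕ) := ⟨n.ne_zero⟩
  have hu : (n : ℕ) • invariantQZ K z = 0 := by rw [← map_nsmul, hz, map_zero]
  obtain ⟨m, hm, hmu⟩ := (AddCircle.nsmul_eq_zero_iff n.pos).1 hu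
  obtain ⟨x, hx⟩ := (invLevel_bijective K (n : ℕ)).2 (m : ZMod (n : ℕ))
  refine ⟨x, invariantQZ_injective ?_⟩
  rw [invariantQZ_of, ← hmu, mul_one, hx, ZMod.val_natCast_of_lt hm]

/-- The structure map lands in the `n`-torsion `H²(G_K, μ_{ℚ/ℤ})[n]`. [cite: MochizukiAbsAnab2004, Prop 1.2.1 (vii) p.11] -/
theorem H2MuQZ.of_mem_torsionBy (n : ℕ+) (x : galoisCohomology (mu K (n : ℕ)) 2) :
    H2MuQZ.of n x ∈ AddSubgroup.torsionBy (H2MuQZ K) ((n : ℕ) : ℤ) :=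
  AddSubgroup.torsionBy.nsmul_iff.2 (H2MuQZ.nsmul_of n x)

/-- **(S1) `H²(G_K, μ_n) ≃ H²(G_K, μ_{ℚ/ℤ})[n]`**: the structure map as an isomorphism onto the `n`-torsion.
[cite: MochizukiAbsAnab2004, Prop 1.2.1 (vii) p.11] -/
def H2MuQZ.torsionEquiv (n : ℕ+) :
    galoisCohomology (mu K (n : ℕ)) 2 ≃+ AddSubgroup.torsionBy (H2MuQZ K) ((n : ℕ) : ℤ) :=
  AddEquiv.ofBijective ((H2MuQZ.of n).codRestrict _ (H2MuQZ.of_mem_torsionBy n))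
    ⟨fun x y h => H2MuQZ.of_injective n (congrArg Subtype.val h),
      fun z => by
        obtain ⟨x, hx⟩ := H2MuQZ.exists_of_eq_of_nsmul_eq_zero (n := n) (z := (z : H2MuQZ K))
          (AddSubgroup.torsionBy.nsmul_iff.1 z.2)
        exact ⟨x, Subtype.ext hx⟩⟩

/-- `torsionEquiv` IS the structure map. [cite: MochizukiAbsAnab2004, Prop 1.2.1 (vii) p.11] -/
@[simp] theorem H2MuQZ.coe_torsionEquiv (n : ℕ+) (x : galoisCohomology (mu K (n : ℕ)) 2) :
    (H2MuQZ.torsionEquiv n x : H2MuQZ K) = H2MuQZ.of n x := rfl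

/-- The inverse of `torsionEquiv` is a section of the structure map. [cite: MochizukiAbsAnab2004, Prop 1.2.1 (vii) p.11] -/
@[simp] theorem H2MuQZ.of_torsionEquiv_symm (n : ℕ+) (z : AddSubgroup.torsionBy (H2MuQZ K) ((n : ℕ) : ℤ)) :
    H2MuQZ.of n ((H2MuQZ.torsionEquiv n).symm z) = z := by
  rw [← H2MuQZ.coe_torsionEquiv, AddEquiv.apply_symm_apply]

omit [ValuativeRel K] [TopologicalSpace K] [IsNonarchimedeanLocalField K] in
/-- **Multiplication by `d` on `H²(G_K, μ_{ℚ/ℤ})` is the power map `H²(μ_N ↠ μ_n)` on levels** (`n d = N`):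
`of_n (H²(μ_N ↠ μ_n) y) = d • of_N y` (from `H²(μ_n ⊆ μ_N) ∘ H²(μ_N ↠ μ_n) = d ·`, abc-iut-L4-t17).
[cite: MochizukiAbsTopIII2015, Cor 1.10 (i) p.42] -/
theorem H2MuQZ.of_cohomologyMap_muPowHom {n N : ℕ+} {d : ℕ} (h : (n : ℕ) * d = N)
    (y : galoisCohomology (mu K (N : ℕ)) 2) :
    H2MuQZ.of n (cohomologyMap (muPowHom K N n d h) 2 y) = d • H2MuQZ.of N y := by
  have key : cohomologyMap (muInclHom K (Dvd.intro d h)) 2 (cohomologyMap (muPowHom K N n d h) 2 y) = d • y :=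
    cohomologyMap_muInclHom_muPowHom K h y
  rw [← H2MuQZ.of_cohomologyMap (Dvd.intro d h) (cohomologyMap (muPowHom K N n d h) 2 y), key, map_nsmul]

end Torsion

/-! ### (S2) `lim_i H²(G_K, μ_{(i+1)!})` along the power maps -/

/-- `cycLevel i * (i + 2) = cycLevel (i + 1)` on `ℕ`. [cite: MochizukiAbsTopIII2015, Cor 1.10 (i) p.41] -/
theorem coe_cycLevel_mul_succ (i : ℕ) : ((cycLevel i : ℕ+) : ℕ) * (i + 2) = ((cycLevel (i + 1) : ℕ+) : ℕ) := by
  rw [cycLevel_succ]; rfl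

section Chain

variable (K : Type u) [Field K]

/-- The power map `H²(G_K, μ_{(i+2)!}) → H²(G_K, μ_{(i+1)!})` (push-forward along `ζ ↦ ζ^{i+2}`) as an additive
homomorphism of the `galoisCohomology` groups — the transition map of the tower `galCyclotomeTower` on `H²`.
[cite: MochizukiAbsTopIII2015, Cor 1.10 (i) p.42] -/
def H2MuPow (i : ℕ) :
    galoisCohomology (mu K ((cycLevel (i + 1) : ℕ+) : ℕ)) 2 →+ galoisCohomology (mu K ((cycLevel i : ℕ+) : ℕ)) 2 :=
  (cohomologyMap (muPowHom K (cycLevel (i + 1)) (cycLevel i) (i + 2) (coe_cycLevel_mul_succ i))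
    2).hom.toLinearMap.toAddMonoidHom

/-- `H2MuPow` is `cohomologyMap (muPowHom …) 2`. [cite: MochizukiAbsTopIII2015, Cor 1.10 (i) p.42] -/
@[simp] theorem H2MuPow_apply (i : ℕ) (x : galoisCohomology (mu K ((cycLevel (i + 1) : ℕ+) : ℕ)) 2) :
    H2MuPow K i x =
      cohomologyMap (muPowHom K (cycLevel (i + 1)) (cycLevel i) (i + 2) (coe_cycLevel_mul_succ i)) 2 x := rfl

/-- **`lim_{← i} H²(G_K, μ_{(i+1)!}(K̄))`**: families of classes compatible under the power maps
`H²(μ_{(i+2)!} ↠ μ_{(i+1)!})`, as an additive subgroup of `∏_i H²(G_K, μ_{(i+1)!})` — the comparison-free form of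
`(galCyclotomeTower φ hφ).limitClasses` (`limitClasses_galCyclotomeTower`). [cite: NeukirchSchmidtWingberg2008, Thm (2.7.5)] -/
def H2MuChainClasses : AddSubgroup (∀ i : ℕ, galoisCohomology (mu K ((cycLevel i : ℕ+) : ℕ)) 2) where
  carrier := {c | ∀ i, H2MuPow K i (c (i + 1)) = c i}
  zero_mem' i := by
    change H2MuPow K i 0 = 0
    exact map_zero _
  add_mem' {a b} ha hb i := by
    change H2MuPow K i (a (i + 1) + b (i + 1)) = a i + b i
    rw [map_add, ha i, hb i]
  neg_mem' {a} ha i := by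
    change H2MuPow K i (-a (i + 1)) = -a i
    rw [map_neg, ha i]

variable {K}

/-- The compatibility of a member of `H2MuChainClasses`. [cite: NeukirchSchmidtWingberg2008, Thm (2.7.5)] -/
theorem H2MuChainClasses.compat (c : H2MuChainClasses K) (i : ℕ) :
    cohomologyMap (muPowHom K (cycLevel (i + 1)) (cycLevel i) (i + 2) (coe_cycLevel_mul_succ i)) 2
      ((c : ∀ i, galoisCohomology (mu K ((cycLevel i : ℕ+) : ℕ)) 2) (i + 1)) =
      (c : ∀ i, galoisCohomology (mu K ((cycLevel i : ℕ+) : ℕ)) 2) i :=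
  c.2 i

/-- **`H2MuChainClasses K` IS `(galCyclotomeTower φ hφ).limitClasses`** for any comparison `φ` (definitional:
the tower's levels and transitions are the `μ_{(i+1)!}(K̄)` and the power maps). [cite: NeukirchSchmidtWingberg2008, Thm (2.7.5)] -/
theorem limitClasses_galCyclotomeTower [CharZero K]
    (φ : muQZ (absoluteGaloisGroup K) ≃+ Additive (CommGroup.torsion (AlgebraicClosure K)ˣ))
    (hφ : ∀ (σ : absoluteGaloisGroup K) (x : muQZ (absoluteGaloisGroup K)),
      (((Additive.toMul (φ (σ • x)) : CommGroup.torsion (AlgebraicClosure K)ˣ) :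
          (AlgebraicClosure K)ˣ) : AlgebraicClosure K) =
        σ • (((Additive.toMul (φ x) : CommGroup.torsion (AlgebraicClosure K)ˣ) :
          (AlgebraicClosure K)ˣ) : AlgebraicClosure K)) :
    (galCyclotomeTower φ hφ).limitClasses = H2MuChainClasses K :=
  rfl

end Chain

section HomQmodZ

variable {K : Type u} [Field K] [ValuativeRel K] [TopologicalSpace K] [IsNonarchimedeanLocalField K]
  [CharZero K]

omit [ValuativeRel K] [TopologicalSpace K] [IsNonarchimedeanLocalField K] in
/-- Along a compatible chain, the images in `H²(G_K, μ_{ℚ/ℤ})` satisfy `of (c_i) = ((j+1)!/(i+1)!) • of (c_j)` for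
`i ≤ j`. [cite: NeukirchSchmidtWingberg2008, Thm (2.7.5)] -/
theorem H2MuChainClasses.of_eq_nsmul_of (c : H2MuChainClasses K) {i j : ℕ} (hij : i ≤ j) :
    H2MuQZ.of (cycLevel i) ((c : ∀ i, galoisCohomology (mu K ((cycLevel i : ℕ+) : ℕ)) 2) i) =
      (((cycLevel j : ℕ+) : ℕ) / ((cycLevel i : ℕ+) : ℕ)) •
        H2MuQZ.of (cycLevel j) ((c : ∀ i, galoisCohomology (mu K ((cycLevel i : ℕ+) : ℕ)) 2) j) := by
  induction hij with
  | refl => rw [Nat.div_self (cycLevel i).pos, one_nsmul]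
  | @step j hij ih =>
    rw [ih, ← H2MuChainClasses.compat c j, H2MuQZ.of_cohomologyMap_muPowHom, ← mul_nsmul]
    congr 1
    rw [← coe_cycLevel_mul_succ j, mul_comm (((cycLevel j : ℕ+) : ℕ)) (j + 2),
      Nat.mul_div_assoc _ (cycLevel_dvd hij)]

omit [ValuativeRel K] [TopologicalSpace K] [IsNonarchimedeanLocalField K] [CharZero K] in
/-- The value `f(1/N)` of `f : ℚ/ℤ → H²(G_K, μ_{ℚ/ℤ})` is `N`-torsion. [cite: MochizukiAbsTopIII2015, Proposition 3.2 (i) p.71] -/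
theorem nsmul_apply_coe_one_div (f : AddCircle (1 : ℚ) →+ H2MuQZ K) (N : ℕ+) :
    (N : ℕ) • f ((((1 : ℚ) / (N : ℕ) : ℚ)) : AddCircle (1 : ℚ)) = 0 := by
  rw [← map_nsmul, ← AddCircle.coe_nsmul, nsmul_eq_mul,
    mul_one_div_cancel (Nat.cast_ne_zero.2 N.ne_zero), AddCircle.coe_period, map_zero]

/-- The level-`(i+1)!` class under `f(1/(i+1)!)`, for `f : ℚ/ℤ → H²(G_K, μ_{ℚ/ℤ})` (via `torsionEquiv`).
[cite: MochizukiAbsTopIII2015, Proposition 3.2 (i) p.71] -/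
def H2MuQZ.homQmodZLevel (f : AddCircle (1 : ℚ) →+ H2MuQZ K) (i : ℕ) :
    galoisCohomology (mu K ((cycLevel i : ℕ+) : ℕ)) 2 :=
  (H2MuQZ.torsionEquiv (cycLevel i)).symm
    ⟨f ((((1 : ℚ) / ((cycLevel i : ℕ+) : ℕ) : ℚ)) : AddCircle (1 : ℚ)),
      AddSubgroup.torsionBy.nsmul_iff.2 (nsmul_apply_coe_one_div f (cycLevel i))⟩

/-- Defining property: `of (homQmodZLevel f i) = f (1/(i+1)!)`. [cite: MochizukiAbsTopIII2015, Proposition 3.2 (i) p.71] -/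
@[simp] theorem H2MuQZ.of_homQmodZLevel (f : AddCircle (1 : ℚ) →+ H2MuQZ K) (i : ℕ) :
    H2MuQZ.of (cycLevel i) (H2MuQZ.homQmodZLevel f i) =
      f ((((1 : ℚ) / ((cycLevel i : ℕ+) : ℕ) : ℚ)) : AddCircle (1 : ℚ)) := by
  rw [H2MuQZ.homQmodZLevel, H2MuQZ.of_torsionEquiv_symm]

/-- The levels of `f` form a compatible chain. [cite: MochizukiAbsTopIII2015, Proposition 3.2 (i) p.71] -/
theorem H2MuQZ.homQmodZLevel_mem (f : AddCircle (1 : ℚ) →+ H2MuQZ K) :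
    (fun i => H2MuQZ.homQmodZLevel f i) ∈ H2MuChainClasses K := by
  intro i
  apply H2MuQZ.of_injective (cycLevel i)
  change H2MuQZ.of (cycLevel i) (cohomologyMap _ 2 (H2MuQZ.homQmodZLevel f (i + 1))) =
    H2MuQZ.of (cycLevel i) (H2MuQZ.homQmodZLevel f i)
  rw [H2MuQZ.of_cohomologyMap_muPowHom, H2MuQZ.of_homQmodZLevel, H2MuQZ.of_homQmodZLevel, ← map_nsmul,
    nsmul_coe_one_div (coe_cycLevel_mul_succ i)]

/-- **`Hom(ℚ/ℤ, H²(G_K, μ_{ℚ/ℤ})) → lim_i H²(G_K, μ_{(i+1)!})`**, `f ↦ (the level-(i+1)! class under f(1/(i+1)!))_i`.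
[cite: MochizukiAbsTopIII2015, Proposition 3.2 (i) p.71] -/
def H2MuQZ.homQmodZToChain : (AddCircle (1 : ℚ) →+ H2MuQZ K) →+ H2MuChainClasses K where
  toFun f := ⟨fun i => H2MuQZ.homQmodZLevel f i, H2MuQZ.homQmodZLevel_mem f⟩
  map_zero' := Subtype.ext (funext fun i => H2MuQZ.of_injective (cycLevel i) (by
    change H2MuQZ.of (cycLevel i) (H2MuQZ.homQmodZLevel 0 i) = H2MuQZ.of (cycLevel i) 0
    rw [H2MuQZ.of_homQmodZLevel, AddMonoidHom.zero_apply, map_zero]))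
  map_add' f g := Subtype.ext (funext fun i => H2MuQZ.of_injective (cycLevel i) (by
    change H2MuQZ.of (cycLevel i) (H2MuQZ.homQmodZLevel (f + g) i) =
      H2MuQZ.of (cycLevel i) (H2MuQZ.homQmodZLevel f i + H2MuQZ.homQmodZLevel g i)
    rw [map_add, H2MuQZ.of_homQmodZLevel, H2MuQZ.of_homQmodZLevel, H2MuQZ.of_homQmodZLevel,
      AddMonoidHom.add_apply]))

/-- Components of `homQmodZToChain`. [cite: MochizukiAbsTopIII2015, Proposition 3.2 (i) p.71] -/
@[simp] theorem H2MuQZ.homQmodZToChain_apply_coe (f : AddCircle (1 : ℚ) →+ H2MuQZ K) (i : ℕ) :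
    (H2MuQZ.homQmodZToChain f : ∀ i, galoisCohomology (mu K ((cycLevel i : ℕ+) : ℕ)) 2) i =
      H2MuQZ.homQmodZLevel f i := rfl

/-- The torsion family of a compatible chain `c`: `n ↦ ((i+1)!/n) • of (c_i)`, `i = n - 1` (so `n ∣ (i+1)!`),
read in `Multiplicative H²(G_K, μ_{ℚ/ℤ})`. [cite: MochizukiAbsTopIII2015, Proposition 3.2 (i) p.71] -/
def H2MuChainClasses.torsionFamily (c : H2MuChainClasses K) (n : ℕ+) : Multiplicative (H2MuQZ K) :=
  Multiplicative.ofAdd ((((cycLevel n.natPred : ℕ+) : ℕ) / (n : ℕ)) •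
    H2MuQZ.of (cycLevel n.natPred) ((c : ∀ i, galoisCohomology (mu K ((cycLevel i : ℕ+) : ℕ)) 2) n.natPred))

omit [ValuativeRel K] [TopologicalSpace K] [IsNonarchimedeanLocalField K] in
/-- Level independence: for any `j ≥ n - 1`, `((j+1)!/n) • of (c_j)` is the `n`-th member of the torsion family.
[cite: NeukirchSchmidtWingberg2008, Thm (2.7.5)] -/
theorem H2MuChainClasses.toAdd_torsionFamily_eq (c : H2MuChainClasses K) (n : ℕ+) {j : ℕ} (hj : n.natPred ≤ j) :
    Multiplicative.toAdd (H2MuChainClasses.torsionFamily c n) =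
      ((((cycLevel j : ℕ+) : ℕ) / (n : ℕ)) •
        H2MuQZ.of (cycLevel j) ((c : ∀ i, galoisCohomology (mu K ((cycLevel i : ℕ+) : ℕ)) 2) j)) := by
  rw [H2MuChainClasses.torsionFamily, toAdd_ofAdd, H2MuChainClasses.of_eq_nsmul_of c hj, ← mul_nsmul]
  congr 1
  rw [Nat.div_mul_div_comm (cycLevel_dvd hj) (dvd_cycLevel_natPred n),
    mul_comm (((cycLevel n.natPred : ℕ+) : ℕ)) (n : ℕ), Nat.mul_div_mul_right _ _ (cycLevel n.natPred).pos]

/-- The torsion family of a compatible chain lies in the cyclotome `Λ(H²(G_K, μ_{ℚ/ℤ}))` (`n`-th member is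
`n`-torsion; `m`-th power/multiple of the `(n m)`-th member is the `n`-th). [cite: MochizukiAbsTopIII2015, Proposition 3.2 (i) p.71] -/
theorem H2MuChainClasses.torsionFamily_mem (c : H2MuChainClasses K) :
    H2MuChainClasses.torsionFamily c ∈ cyclotome (Multiplicative (H2MuQZ K)) := by
  refine ⟨fun n => ?_, fun n m => ?_⟩
  · rw [H2MuChainClasses.torsionFamily, ← ofAdd_nsmul, ← mul_nsmul, Nat.div_mul_cancel (dvd_cycLevel_natPred n),
      H2MuQZ.nsmul_of, ofAdd_zero]
  · have hle : n.natPred ≤ (n * m).natPred := by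
      change (n : ℕ) - 1 ≤ ((n * m : ℕ+) : ℕ) - 1
      rw [PNat.mul_coe]
      exact Nat.sub_le_sub_right (Nat.le_mul_of_pos_right _ m.pos) 1
    apply Multiplicative.toAdd.injective
    rw [toAdd_pow, H2MuChainClasses.toAdd_torsionFamily_eq c (n * m) le_rfl,
      H2MuChainClasses.toAdd_torsionFamily_eq c n hle, ← mul_nsmul]
    congr 1
    have hdvd : (n : ℕ) * (m : ℕ) ∣ ((cycLevel (n * m).natPred : ℕ+) : ℕ) :=
      (PNat.mul_coe n m) ▸ dvd_cycLevel_natPred (n * m)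
    rw [PNat.mul_coe, ← Nat.div_div_eq_div_mul, Nat.div_mul_cancel (Nat.dvd_div_of_mul_dvd hdvd)]

/-- The element of `Λ(H²(G_K, μ_{ℚ/ℤ}))` attached to a compatible chain. [cite: MochizukiAbsTopIII2015, Proposition 3.2 (i) p.71] -/
def H2MuChainClasses.toCyclotome (c : H2MuChainClasses K) : cyclotome (Multiplicative (H2MuQZ K)) :=
  ⟨H2MuChainClasses.torsionFamily c, H2MuChainClasses.torsionFamily_mem c⟩

/-- **`lim_i H²(G_K, μ_{(i+1)!}) → Hom(ℚ/ℤ, H²(G_K, μ_{ℚ/ℤ}))`**: the homomorphism `1/n ↦ ((i+1)!/n) • of (c_i)`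
(via `cyclotome.toHom`, additively). [cite: MochizukiAbsTopIII2015, Proposition 3.2 (i) p.71] -/
def H2MuChainClasses.toHomQmodZ (c : H2MuChainClasses K) : AddCircle (1 : ℚ) →+ H2MuQZ K :=
  AddMonoidHom.toMultiplicative.symm (cyclotome.toHom (H2MuChainClasses.toCyclotome c))

/-- Value of `toHomQmodZ c` on `1/n`. [cite: MochizukiAbsTopIII2015, Proposition 3.2 (i) p.71] -/
theorem H2MuChainClasses.toHomQmodZ_apply_coe_one_div (c : H2MuChainClasses K) (n : ℕ+) :
    H2MuChainClasses.toHomQmodZ c ((((1 : ℚ) / (n : ℕ) : ℚ)) : AddCircle (1 : ℚ)) =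
      ((((cycLevel n.natPred : ℕ+) : ℕ) / (n : ℕ)) •
        H2MuQZ.of (cycLevel n.natPred) ((c : ∀ i, galoisCohomology (mu K ((cycLevel i : ℕ+) : ℕ)) 2) n.natPred)) := by
  change Multiplicative.toAdd (cyclotome.toHom (H2MuChainClasses.toCyclotome c) (Multiplicative.ofAdd _)) = _
  rw [cyclotome.toHom_ofAdd_inv]
  rfl

/-- Value of `toHomQmodZ c` on `1/(i+1)!`: the image of `c_i`. [cite: MochizukiAbsTopIII2015, Proposition 3.2 (i) p.71] -/
theorem H2MuChainClasses.toHomQmodZ_apply_coe_one_div_cycLevel (c : H2MuChainClasses K) (i : ℕ) :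
    H2MuChainClasses.toHomQmodZ c ((((1 : ℚ) / ((cycLevel i : ℕ+) : ℕ) : ℚ)) : AddCircle (1 : ℚ)) =
      H2MuQZ.of (cycLevel i) ((c : ∀ i, galoisCohomology (mu K ((cycLevel i : ℕ+) : ℕ)) 2) i) := by
  have h1 : i + 1 ≤ ((cycLevel i : ℕ+) : ℕ) := by rw [coe_cycLevel]; exact Nat.self_le_factorial _
  have hi : i ≤ (cycLevel i).natPred := by have h2 := PNat.natPred_add_one (cycLevel i); omega
  rw [H2MuChainClasses.toHomQmodZ_apply_coe_one_div, ← H2MuChainClasses.of_eq_nsmul_of c hi]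

/-- `Φ ∘ Ψ = id`: the chain of the homomorphism of a chain is the chain. [cite: NeukirchSchmidtWingberg2008, Thm (2.7.5)] -/
theorem H2MuQZ.homQmodZToChain_toHomQmodZ (c : H2MuChainClasses K) :
    H2MuQZ.homQmodZToChain (H2MuChainClasses.toHomQmodZ c) = c := by
  refine Subtype.ext (funext fun i => H2MuQZ.of_injective (cycLevel i) ?_)
  change H2MuQZ.of (cycLevel i) (H2MuQZ.homQmodZLevel (H2MuChainClasses.toHomQmodZ c) i) =
    H2MuQZ.of (cycLevel i) ((c : ∀ i, galoisCohomology (mu K ((cycLevel i : ℕ+) : ℕ)) 2) i)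
  rw [H2MuQZ.of_homQmodZLevel, H2MuChainClasses.toHomQmodZ_apply_coe_one_div_cycLevel]

/-- `Ψ ∘ Φ = id`: a homomorphism out of `ℚ/ℤ` is recovered from its chain (both agree on every `1/n`).
[cite: MochizukiAbsTopIII2015, Proposition 3.2 (i) p.71] -/
theorem H2MuChainClasses.toHomQmodZ_homQmodZToChain (f : AddCircle (1 : ℚ) →+ H2MuQZ K) :
    H2MuChainClasses.toHomQmodZ (H2MuQZ.homQmodZToChain f) = f := by
  refine addMonoidHom_addCircle_ext fun n => ?_
  rw [H2MuChainClasses.toHomQmodZ_apply_coe_one_div, H2MuQZ.homQmodZToChain_apply_coe,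
    H2MuQZ.of_homQmodZLevel, ← map_nsmul,
    nsmul_coe_one_div (Nat.mul_div_cancel' (dvd_cycLevel_natPred n))]

/-- **(S2) `Hom(ℚ/ℤ, H²(G_K, μ_{ℚ/ℤ})) ≃ lim_{← i} H²(G_K, μ_{(i+1)!})`** — «applying the functor `Hom(ℚ/ℤ, −)`»
([AbsTopIII] Prop. 3.2 (i) p. 71 l. 57) lands in the inverse limit along the power maps, i.e. in
`(galCyclotomeTower φ hφ).limitClasses` (`limitClasses_galCyclotomeTower`), the target of
`DiscreteTowerPresentation.limitClassesEquiv : H²(G_K, μ_Ẑ(G_K)) ≃+ lim_i H²(G_K, μ_{(i+1)!})`.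
[cite: MochizukiAbsTopIII2015, Proposition 3.2 (i) p.71] -/
def H2MuQZ.homQmodZChainEquiv : (AddCircle (1 : ℚ) →+ H2MuQZ K) ≃+ H2MuChainClasses K where
  toFun := H2MuQZ.homQmodZToChain
  invFun := H2MuChainClasses.toHomQmodZ
  left_inv := H2MuChainClasses.toHomQmodZ_homQmodZToChain
  right_inv := H2MuQZ.homQmodZToChain_toHomQmodZ
  map_add' := map_add H2MuQZ.homQmodZToChain

/-- The defining square of (S2): `of_{(i+1)!} ((homQmodZChainEquiv f)_i) = f (1/(i+1)!)`.
[cite: MochizukiAbsTopIII2015, Proposition 3.2 (i) p.71] -/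
theorem H2MuQZ.of_homQmodZChainEquiv_apply (f : AddCircle (1 : ℚ) →+ H2MuQZ K) (i : ℕ) :
    H2MuQZ.of (cycLevel i) ((H2MuQZ.homQmodZChainEquiv f : ∀ i, galoisCohomology (mu K ((cycLevel i : ℕ+) : ℕ)) 2) i) =
      f ((((1 : ℚ) / ((cycLevel i : ℕ+) : ℕ) : ℚ)) : AddCircle (1 : ℚ)) :=
  H2MuQZ.of_homQmodZLevel f i

/-- (S2) and THE residue maps: the residue `invariantQZ (f (1/(i+1)!)) ∈ ℚ/ℤ` is `inv_{(i+1)!}/(i+1)!` of the level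
class `(homQmodZChainEquiv f)_i` (the levelwise content of «`Hom(ℚ/ℤ, H²(G, μ_{ℚ/ℤ}) ⥲ ℚ/ℤ)`»).
[cite: MochizukiAbsTopIII2015, Proposition 3.2 (i) p.71] -/
theorem invariantQZ_apply_coe_one_div_cycLevel (f : AddCircle (1 : ℚ) →+ H2MuQZ K) (i : ℕ) :
    invariantQZ K (f ((((1 : ℚ) / ((cycLevel i : ℕ+) : ℕ) : ℚ)) : AddCircle (1 : ℚ))) =
      zmodToQmodZ ((cycLevel i : ℕ+) : ℕ) (invLevel K ((cycLevel i : ℕ+) : ℕ)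
        ((H2MuQZ.homQmodZChainEquiv f : ∀ i, galoisCohomology (mu K ((cycLevel i : ℕ+) : ℕ)) 2) i)) := by
  rw [← H2MuQZ.of_homQmodZChainEquiv_apply, invariantQZ_of']

end HomQmodZ

end Prop121vii

end Literature.AnabelianGeometry.AbsoluteAnabelian

end
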